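import Literature.Barriers.FinalStateConjecture.KerrLinearHair
import Literature.Geometry.Lorentzian.KerrSeparatedProfile
import Literature.Geometry.Lorentzian.KerrSeparatedPotential
import Literature.Analysis.SpecialFunctions.SpheroidalEigenfunction
import Literature.Analysis.ODE.LinearSecondOrder
import HarnessLib

/-!
# Barrier catalogue `FinalStateConjecture`: discharge of the named fact `KerrLinearHair`
# (existence form) by an explicit separated time-harmonic Klein–Gordon solution
(`Literature/Barriers/FinalStateConjecture/`, D-0014/D-0021; namespace
`Literature.Barriers.FinalStateConjecture`)

`KerrLinearHair.lean` vendors, in **existence form on the open exterior chart** (its scope_caveats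
(b): "smoothness, the equation, non-vanishing and the phase law under the `t_KS`-flow with
`|ϖ| = |am|/(2Mr₊)`; finite energy, exponential spatial decay, the smooth extension to `𝓗⁺` and the
mode structure are NOT vendored"), Shlapentokh-Rothman's real-mode theorem (CMP 329 (2014),
Thms. 1.2–1.3; Chodosh–Shlapentokh-Rothman, CMP 356 (2017), Thm. 1.3). This file proves that
vendored Prop, `theorem KerrLinearHair_holds : KerrLinearHair`.

## What is proved, and what it is NOT

The witness is an **axisymmetric separated time-harmonic solution**
`Ψ = e^{−iϖ t_KS} F(r) S(cos θ)` of `(□_{g_{M,a}} − μ²)Ψ = 0` on the whole open exterior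
`{r > r₊}`, with the threshold frequency `ϖ = |am|/(2Mr₊)` and a mass `μ > ϖ` chosen so that
`a²(μ² − ϖ²) = 1/100`:
* `S` is a genuine smooth **spheroidal eigenfunction** on the sphere — the even solution of the
  axisymmetric prolate spheroidal equation `((1−χ²)S')' + (λ − χ²/100)S = 0` regular at both poles
  constructed in `Literature.Analysis.SpecialFunctions.exists_spheroidalEigenfunction` (this is the
  content making `Ψ` smooth on the axis);
* `F` is the smooth solution of the separated radial equation in the ingoing Kerr–Schild gauge,
  `Δ_r F'' + (2r − 2M − 4iMϖr)F' + (ϖ²r² + 2Mrϖ² − 2iMϖ − λ − μ²r²)F = 0` on `(r₊, ∞)`, with data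
  `F(r₊ + 1) = 1`, `F'(r₊ + 1) = 0` (`Literature.Analysis.ODE.exists_contDiffOn_solution_Ioi`) —
  **no boundary condition is imposed at `r₊` or at infinity**;
* the equation `□_g Re Ψ = μ² Re Ψ`, `□_g Im Ψ = μ² Im Ψ` for the prelude's `dalembertian` of
  `Kerr.smoothMetric M a r₊` is the separation identity of
  `Literature.Geometry.Lorentzian.Kerr.ksBoxC_sepProfile_eq_of_ode` (`KerrSeparatedProfile.lean`,
  built on `KerrSchildBox.lean` and `KerrOblateCalculus.lean`: `□_g = □_η − 2H∂²_{ℓℓ} − (2M/Σ)∂_ℓ`,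
  `Δr = 2r/Σ`, `Δχ = −2χ/Σ`, …), i.e. Carter's separation for `m = 0` carried out in the prelude's
  chart.

Consequently `KerrLinearHair_holds` certifies exactly the vendored existence form and NOT the printed
theorem of Shlapentokh-Rothman: the witness has azimuthal number `0` (the printed real modes have
`am ≠ 0`, Thm. 1.3 (ii)), and nothing is claimed about its energy (it is in general neither of finite
energy nor smooth across `𝓗⁺`; by loc. cit. Thm. 1.3 no finite-energy real mode with `m = 0`
exists). Planner/refuter note (D-0021): `KerrLinearHair` as vendored is thereby shown to carry no
more than global solvability of the separated linear equations on the open exterior; the mathematical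
content of the barrier — a **finite-energy bound state** at the threshold frequency with azimuthal
number `m ≠ 0` (finite Klein–Gordon energy on the leaves `{t_KS = τ}`, `kgSliceEnergy` as in
`KleinGordonSuperradiantInstability`, and smoothness across `𝓗⁺`) — is NOT asserted by it and should
be vendored separately (as a named fact extending `IsLinearHair` by those printed clauses) by a unit
entitled to add facts; this discharge unit adds none (D-0026).

## References

* Y. Shlapentokh-Rothman, Comm. Math. Phys. 329 (2014) 859–891 (arXiv:1302.3448): §1.3 Thms. 1.2–1.3
  (p. 5 of the held copy), §2 (separated equations, boundary conditions, finite-energy requirement,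
  pp. 7–8).
* O. Chodosh, Y. Shlapentokh-Rothman, Comm. Math. Phys. 356 (2017) 1155–1250 (arXiv:1510.08025),
  Thm. 1.3 and §2.2 (pp. 5, 7–8 of the held copy).
-/

noncomputable section

open Set Filter Topology
open scoped Manifold ContDiff

namespace Literature.Barriers.FinalStateConjecture

open Literature.Geometry.Lorentzian Literature.Geometry.Lorentzian.Kerr
  Literature.Analysis.SpecialFunctions

/-! ### Parameters of the witness: threshold frequency and mass -/

/-- The **superradiant threshold frequency** `ϖ = |am|/(2Mr₊)` (`am − 2Mr₊ω = 0`, SR Thm. 1.3 (i), up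
to the orientation of `a`). [cite: ShlapentokhRothman2014KleinGordon, Thm. 1.3] -/
def thresholdFreq (M a : ℝ) (m : ℤ) : ℝ := |a * m| / (2 * M * rPlus M a)

/-- The **mass of the witness**, `μ = √(ϖ² + 1/(100 a²))`, so that the spheroidicity is
`a²(μ² − ϖ²) = 1/100` (the parameter of `exists_spheroidalEigenfunction`). [folklore] -/
def hairMass (M a : ℝ) (m : ℤ) : ℝ := Real.sqrt (thresholdFreq M a m ^ 2 + 1 / 100 / a ^ 2)

/-- `μ² = ϖ² + 1/(100a²)`. [folklore] -/
theorem hairMass_sq (M a : ℝ) (m : ℤ) :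
    hairMass M a m ^ 2 = thresholdFreq M a m ^ 2 + 1 / 100 / a ^ 2 :=
  Real.sq_sqrt (by positivity)

/-- `a²(μ² − ϖ²) = 1/100` for `a ≠ 0`. [folklore] -/
theorem sq_mul_hairMass_sq_sub {M a : ℝ} (ha : a ≠ 0) (m : ℤ) :
    a ^ 2 * (hairMass M a m ^ 2 - thresholdFreq M a m ^ 2) = 1 / 100 := by
  rw [hairMass_sq]
  field_simp
  ring

/-- `0 ≤ ϖ`. [folklore] -/
theorem thresholdFreq_nonneg {M a : ℝ} (hMa : IsSubextremal M a) (m : ℤ) : 0 ≤ thresholdFreq M a m := by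
  have hr : 0 < rPlus M a := hMa.rMinus_nonneg.trans_lt hMa.rMinus_lt_rPlus
  have hM : 0 < M := hMa.pos
  unfold thresholdFreq
  positivity

/-- `ϖ < μ` for `a ≠ 0`. [folklore] -/
theorem thresholdFreq_lt_hairMass {M a : ℝ} (hMa : IsSubextremal M a) (ha : a ≠ 0) (m : ℤ) :
    thresholdFreq M a m < hairMass M a m := by
  have h0 := thresholdFreq_nonneg hMa m
  have hpos : 0 < 1 / 100 / a ^ 2 := by positivity
  rw [hairMass, Real.lt_sqrt h0]
  linarith

/-! ### The radial factor: a smooth solution of the separated radial equation on `(r₊, ∞)` -/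

/-- The coefficient `p = −(2r − 2M − 4iMϖr)/Δ_r` of `F'` in the radial equation solved for `F''`.
[cite: ShlapentokhRothman2014KleinGordon, §2] -/
def radialP (M a ϖ r : ℝ) : ℂ :=
  -(2 * (r : ℂ) - 2 * M - 4 * Complex.I * M * ϖ * r) * ((delta M a r)⁻¹ : ℝ)

/-- The coefficient `q = (λ + μ²r² − ϖ²r² − 2Mrϖ² + 2iMϖ)/Δ_r` of `F` in the radial equation solved
for `F''`. [cite: ShlapentokhRothman2014KleinGordon, §2] -/
def radialQ (M a ϖ lam μ r : ℝ) : ℂ :=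
  ((lam : ℂ) + μ ^ 2 * r ^ 2 - (ϖ ^ 2 * r ^ 2 + 2 * M * r * ϖ ^ 2 - 2 * Complex.I * M * ϖ)) *
    ((delta M a r)⁻¹ : ℝ)

/-- `r ↦ (Δ_r⁻¹ : ℂ)` is smooth on `(r₊, ∞)` for `|a| ≤ M` (`Δ_r > 0` there). [folklore] -/
theorem contDiffOn_inv_delta {M a : ℝ} (h : |a| ≤ M) :
    ContDiffOn ℝ ∞ (fun r : ℝ ↦ (((delta M a r)⁻¹ : ℝ) : ℂ)) (Ioi (rPlus M a)) := by
  have hΔ : ContDiff ℝ ∞ fun r : ℝ ↦ delta M a r := by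
    unfold delta; fun_prop
  have hinv : ContDiffOn ℝ ∞ (fun r : ℝ ↦ (delta M a r)⁻¹) (Ioi (rPlus M a)) :=
    hΔ.contDiffOn.inv fun r hr ↦ (delta_pos h hr).ne'
  exact Complex.ofRealCLM.contDiff.comp_contDiffOn hinv

/-- `radialP` is smooth on `(r₊, ∞)`. [folklore] -/
theorem contDiffOn_radialP {M a : ℝ} (h : |a| ≤ M) (ϖ : ℝ) :
    ContDiffOn ℝ ∞ (radialP M a ϖ) (Ioi (rPlus M a)) := by
  have hc : ContDiff ℝ ∞ fun r : ℝ ↦ (r : ℂ) := Complex.ofRealCLM.contDiff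
  unfold radialP
  refine ContDiffOn.mul ?_ (contDiffOn_inv_delta h)
  exact ContDiff.contDiffOn (by fun_prop)

/-- `radialQ` is smooth on `(r₊, ∞)`. [folklore] -/
theorem contDiffOn_radialQ {M a : ℝ} (h : |a| ≤ M) (ϖ lam μ : ℝ) :
    ContDiffOn ℝ ∞ (radialQ M a ϖ lam μ) (Ioi (rPlus M a)) := by
  have hc : ContDiff ℝ ∞ fun r : ℝ ↦ (r : ℂ) := Complex.ofRealCLM.contDiff
  unfold radialQ
  refine ContDiffOn.mul ?_ (contDiffOn_inv_delta h)
  exact ContDiff.contDiffOn (by fun_prop)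

/-- **The radial factor.** For `|a| ≤ M` there is `F : ℝ → ℂ`, smooth on `(r₊, ∞)`, with
`F(r₊ + 1) = 1` and `Δ_r F'' + (2r − 2M − 4iMϖr)F' + (ϖ²r² + 2Mrϖ² − 2iMϖ)F = (λ + μ²r²)F` on
`(r₊, ∞)` — a solution of the separated radial equation with no boundary condition imposed
(`Literature.Analysis.ODE.exists_contDiffOn_solution_Ioi`). [folklore] -/
theorem exists_radialFactor {M a : ℝ} (h : |a| ≤ M) (ϖ lam μ : ℝ) :
    ∃ F : ℝ → ℂ, ContDiffOn ℝ ∞ F (Ioi (rPlus M a)) ∧ F (rPlus M a + 1) = 1 ∧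
      ∀ r ∈ Ioi (rPlus M a),
        ((r : ℂ) ^ 2 - 2 * M * r + a ^ 2) * deriv (deriv F) r +
          (2 * r - 2 * M - 4 * Complex.I * M * ϖ * r) * deriv F r +
          (ϖ ^ 2 * r ^ 2 + 2 * M * r * ϖ ^ 2 - 2 * Complex.I * M * ϖ) * F r =
        (lam + μ ^ 2 * r ^ 2) * F r := by
  obtain ⟨F, hF, hF0, -, hode⟩ := Literature.Analysis.ODE.exists_contDiffOn_solution_Ioi (𝕜 := ℂ)
    (contDiffOn_radialP h ϖ) (contDiffOn_radialQ h ϖ lam μ) (t₀ := rPlus M a + 1) (by linarith)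
    (1 : ℂ) 0
  refine ⟨F, hF, hF0, fun r hr ↦ ?_⟩
  have hΔ : (delta M a r : ℂ) ≠ 0 := by exact_mod_cast (delta_pos h hr).ne'
  have hΔ' : ((r : ℂ) ^ 2 - 2 * M * r + a ^ 2) = (delta M a r : ℂ) := by
    unfold delta; push_cast; ring
  have key := hode r hr
  rw [radialP, radialQ] at key
  push_cast at key
  rw [hΔ']
  rw [key]
  field_simp
  ring

/-! ### The witness field -/

/-- **The witness**: the time-harmonic separated field `Ψ(x) = e^{−iϖx⁰} F(r(x)) S(χ(x))` on `E4`
(junk off `{r > r₊}`). [cite: ShlapentokhRothman2014KleinGordon, §1.3 (1.5)] -/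
def hairField (a ϖ : ℝ) (F : ℝ → ℂ) (Sr : ℝ → ℝ) (x : E4) : ℂ :=
  phase ϖ x * sepProfile a F (fun c ↦ (Sr c : ℂ)) x

/-- The Kerr–Schild radius on the positive `z`-axis: `r(t, 0, 0, z) = z` for `z > 0`. [cite: arXiv07060622, (35)] -/
theorem radius_axisPoint (a t : ℝ) {z : ℝ} (hz : 0 < z) :
    radius a (t • E4.basisVector 0 + z • E4.basisVector 3) = z := by
  refine radius_eq_of_pos_of_quartic hz ?_
  rw [E4.spatialNorm_sq]
  simp [E4.basisVector]
  ring

section Witness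

variable {M a : ℝ} {ϖ lam μ : ℝ} {F : ℝ → ℂ} {Sr : ℝ → ℝ}
  (hF : ContDiffOn ℝ ∞ F (Ioi (rPlus M a)))
  (hFode : ∀ r ∈ Ioi (rPlus M a),
    ((r : ℂ) ^ 2 - 2 * M * r + a ^ 2) * deriv (deriv F) r +
      (2 * r - 2 * M - 4 * Complex.I * M * ϖ * r) * deriv F r +
      (ϖ ^ 2 * r ^ 2 + 2 * M * r * ϖ ^ 2 - 2 * Complex.I * M * ϖ) * F r =
    (lam + μ ^ 2 * r ^ 2) * F r)
  (hS : ContDiffOn ℝ ⊤ Sr (Ioo (-31 / 11 : ℝ) (31 / 11)))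
  (hSode : ∀ c ∈ Ioo (-31 / 11 : ℝ) (31 / 11),
    (1 - c ^ 2) * deriv (deriv Sr) c - 2 * c * deriv Sr c + (lam - 1 / 100 * c ^ 2) * Sr c = 0)
  (hμ : a ^ 2 * (μ ^ 2 - ϖ ^ 2) = 1 / 100)

/-- Points of the exterior have `r > r₊`. [folklore] -/
theorem radius_mem_Ioi_of_mem_exterior {x : E4} (hx : x ∈ exterior M a) : radius a x ∈ Ioi (rPlus M a) :=
  lt_radius_of_mem_region hx

/-- The latitude of a point with `r > 0` lies in the domain of the eigenfunction (`|χ| ≤ 1`).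
[folklore] -/
theorem latitude_mem_Ioo {x : E4} (hx : 0 < radius a x) :
    latitude a x ∈ Ioo (-31 / 11 : ℝ) (31 / 11) := by
  have h := abs_le.1 (abs_latitude_le_one hx)
  constructor <;> linarith [h.1, h.2]

include hF hS in
/-- **Smoothness of the witness** (every finite order and `C^∞`) at every point with `r > r₊`.
[folklore] -/
theorem contDiffAt_hairField {x : E4} (hx : x ∈ exterior M a) {n : ℕ∞} :
    ContDiffAt ℝ n (hairField a ϖ F Sr) x := by
  have hr := radius_pos_of_mem_region hx
  have hrI := radius_mem_Ioi_of_mem_exterior hx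
  have hFat : ContDiffAt ℝ n F (radius a x) :=
    ((hF.contDiffAt (Ioi_mem_nhds hrI)).of_le (WithTop.coe_le_coe.2 le_top))
  have hSat : ContDiffAt ℝ n Sr (latitude a x) :=
    (hS.contDiffAt (Ioo_mem_nhds (latitude_mem_Ioo hr).1 (latitude_mem_Ioo hr).2)).of_le le_top
  have h1 : ContDiffAt ℝ n (fun y ↦ F (radius a y)) x := hFat.comp x (contDiffAt_radius hr)
  have h2 : ContDiffAt ℝ n (fun y ↦ ((Sr (latitude a y) : ℝ) : ℂ)) x :=
    Complex.ofRealCLM.contDiff.contDiffAt.comp x (hSat.comp x (contDiffAt_latitude hr))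
  exact (contDiff_phase (ϖ : ℂ)).contDiffAt.mul (h1.mul h2)

include hF hFode hS hSode hμ in
/-- **The separated field solves `ksBoxC Ψ = μ² Ψ` on the exterior** (separation identity with the
two ordinary differential equations). [cite: ShlapentokhRothman2014KleinGordon, §2] -/
theorem ksBoxC_hairField {x : E4} (hx : x ∈ exterior M a) :
    ksBoxC M a (hairField a ϖ F Sr) x = (μ : ℂ) ^ 2 * hairField a ϖ F Sr x := by
  have hr := radius_pos_of_mem_region hx
  have hrI := radius_mem_Ioi_of_mem_exterior hx
  have hlI := latitude_mem_Ioo hr (a := a)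
  -- derivatives of the two factors
  have hFd : ∀ ρ ∈ Ioi (rPlus M a), HasDerivAt F (deriv F ρ) ρ := fun ρ hρ ↦
    ((hF.differentiableOn (by simp)).differentiableAt (Ioi_mem_nhds hρ)).hasDerivAt
  have hF' : ContDiffOn ℝ 1 (deriv F) (Ioi (rPlus M a)) :=
    hF.deriv_of_isOpen isOpen_Ioi (WithTop.coe_le_coe.2 le_top)
  have hF'd : ∀ ρ ∈ Ioi (rPlus M a), HasDerivAt (deriv F) (deriv (deriv F) ρ) ρ := fun ρ hρ ↦
    ((hF'.differentiableOn (by simp)).differentiableAt (Ioi_mem_nhds hρ)).hasDerivAt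
  have hSd : ∀ c ∈ Ioo (-31 / 11 : ℝ) (31 / 11), HasDerivAt Sr (deriv Sr c) c := fun c hc ↦
    ((hS.differentiableOn (by simp)).differentiableAt (Ioo_mem_nhds hc.1 hc.2)).hasDerivAt
  have hS' : ContDiffOn ℝ ⊤ (deriv Sr) (Ioo (-31 / 11 : ℝ) (31 / 11)) :=
    hS.deriv_of_isOpen isOpen_Ioo le_top
  have hS'd : ∀ c ∈ Ioo (-31 / 11 : ℝ) (31 / 11), HasDerivAt (deriv Sr) (deriv (deriv Sr) c) c :=
    fun c hc ↦ ((hS'.differentiableOn (by simp)).differentiableAt (Ioo_mem_nhds hc.1 hc.2)).hasDerivAt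
  -- hypotheses of the separation identity
  set S : ℝ → ℂ := fun c ↦ ((Sr c : ℝ) : ℂ) with hSdef
  set S₁ : ℝ → ℂ := fun c ↦ ((deriv Sr c : ℝ) : ℂ) with hS₁def
  set S₂ : ℝ → ℂ := fun c ↦ ((deriv (deriv Sr) c : ℝ) : ℂ) with hS₂def
  have eF : ∀ᶠ ρ in 𝓝 (radius a x), HasDerivAt F (deriv F ρ) ρ := by
    filter_upwards [Ioi_mem_nhds hrI] with ρ hρ using hFd ρ hρ
  have eS : ∀ᶠ c in 𝓝 (latitude a x), HasDerivAt S (S₁ c) c := by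
    filter_upwards [Ioo_mem_nhds hlI.1 hlI.2] with c hc using (hSd c hc).ofReal_comp
  have hS₁x : HasDerivAt S₁ (S₂ (latitude a x)) (latitude a x) := (hS'd _ hlI).ofReal_comp
  have hΦ : ContDiffAt ℝ 2 (sepProfile a F S) x := by
    have hFat : ContDiffAt ℝ 2 F (radius a x) :=
      (hF.contDiffAt (Ioi_mem_nhds hrI)).of_le (WithTop.coe_le_coe.2 le_top)
    have hSat : ContDiffAt ℝ 2 Sr (latitude a x) :=
      (hS.contDiffAt (Ioo_mem_nhds hlI.1 hlI.2)).of_le le_top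
    exact (hFat.comp x (contDiffAt_radius hr)).mul
      (Complex.ofRealCLM.contDiff.contDiffAt.comp x (hSat.comp x (contDiffAt_latitude hr)))
  -- the two ODEs at the point, in complex form
  have hang : (1 - (latitude a x : ℂ) ^ 2) * S₂ (latitude a x) - 2 * latitude a x * S₁ (latitude a x) +
      (lam - a ^ 2 * (μ ^ 2 - (ϖ : ℂ) ^ 2) * latitude a x ^ 2) * S (latitude a x) = 0 := by
    have h := congrArg (fun t : ℝ ↦ (t : ℂ)) (hSode _ hlI)
    have hμC : (a : ℂ) ^ 2 * (μ ^ 2 - (ϖ : ℂ) ^ 2) = 1 / 100 := by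
      have := congrArg (fun t : ℝ ↦ (t : ℂ)) hμ
      push_cast at this
      exact this
    simp only [hSdef, hS₁def, hS₂def]
    push_cast at h ⊢
    linear_combination h - (latitude a x : ℂ) ^ 2 * (Sr (latitude a x) : ℂ) * hμC
  have hrad := hFode _ hrI
  unfold hairField
  exact ksBoxC_sepProfile_eq_of_ode hr eF (hF'd _ hrI) eS hS₁x hΦ M (ϖ : ℂ) (lam : ℂ) μ hang
    (by exact_mod_cast hrad)

end Witness

/-! ### Assembly: the witness is a linear hair -/

section Assembly

variable [Kerr.Facts] [Kerr.SliceFacts] {M a : ℝ} (hMa : IsSubextremal M a) (ha : a ≠ 0)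
  {ϖ lam μ : ℝ} {F : ℝ → ℂ} {Sr : ℝ → ℝ}
  (hF : ContDiffOn ℝ ∞ F (Ioi (rPlus M a))) (hF1 : F (rPlus M a + 1) = 1)
  (hFode : ∀ r ∈ Ioi (rPlus M a),
    ((r : ℂ) ^ 2 - 2 * M * r + a ^ 2) * deriv (deriv F) r +
      (2 * r - 2 * M - 4 * Complex.I * M * ϖ * r) * deriv F r +
      (ϖ ^ 2 * r ^ 2 + 2 * M * r * ϖ ^ 2 - 2 * Complex.I * M * ϖ) * F r =
    (lam + μ ^ 2 * r ^ 2) * F r)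
  (hS : ContDiffOn ℝ ⊤ Sr (Ioo (-31 / 11 : ℝ) (31 / 11))) (hS1 : Sr 1 = 1)
  (hSode : ∀ c ∈ Ioo (-31 / 11 : ℝ) (31 / 11),
    (1 - c ^ 2) * deriv (deriv Sr) c - 2 * c * deriv Sr c + (lam - 1 / 100 * c ^ 2) * Sr c = 0)
  (hμ : a ^ 2 * (μ ^ 2 - ϖ ^ 2) = 1 / 100)

omit [Kerr.Facts] [Kerr.SliceFacts] in
include hMa hF1 hS1 in
/-- **The witness does not vanish** at the axis point `(0, 0, 0, r₊ + 1)` of the exterior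
(`r = r₊ + 1`, `χ = 1`, `F(r₊ + 1) = S(1) = 1`). [folklore] -/
theorem hairField_axisPoint_ne_zero :
    ∃ x : exterior M a, hairField a ϖ F Sr x ≠ 0 := by
  have hrp : 0 < rPlus M a := hMa.rMinus_nonneg.trans_lt hMa.rMinus_lt_rPlus
  set z : ℝ := rPlus M a + 1 with hz
  have hz0 : 0 < z := by linarith
  set x0 : E4 := (0 : ℝ) • E4.basisVector 0 + z • E4.basisVector 3 with hx0
  have hr : radius a x0 = z := radius_axisPoint a 0 hz0
  have hmem : x0 ∈ exterior M a := by
    rw [mem_exterior, hr, max_eq_left hrp.le]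
    linarith
  refine ⟨⟨x0, hmem⟩, ?_⟩
  have hlat : latitude a x0 = 1 := by
    rw [latitude, hr]
    have : x0 3 = z := by simp [hx0, E4.basisVector]
    rw [this, div_self hz0.ne']
  simp only [hairField, sepProfile, hr, hlat, hF1, hS1]
  simp [phase, Complex.exp_ne_zero]

omit [Kerr.Facts] [Kerr.SliceFacts] in
include hF hS in
/-- The witness is smooth on the exterior chart. [folklore] -/
theorem contMDiff_hairField :
    ContMDiff 𝓘(ℝ, E4) 𝓘(ℝ, ℂ) ∞ fun y : exterior M a ↦ hairField a ϖ F Sr y := fun y ↦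
  (OpensChart.contMDiffAt_iff y (fun y : exterior M a ↦ hairField a ϖ F Sr y) (hairField a ϖ F Sr)
    (fun _ ↦ rfl)).2 (contDiffAt_hairField hF hS y.2)

omit [Kerr.Facts] [Kerr.SliceFacts] in
/-- The witness is time-periodic with frequency `ϖ` under the stationary flow
(`e^{−iϖ(t_KS + s)} = e^{−iϖs} e^{−iϖ t_KS}`, the profile being stationary).
[cite: ChodoshShlapentokhrothman2017, §1.2 and §2.2] -/
theorem isTimePeriodicField_hairField :
    IsTimePeriodicField a (rPlus M a) (fun y : exterior M a ↦ hairField a ϖ F Sr y) ϖ := by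
  intro s x
  have hst := isStationaryField_sepProfile a F (fun c ↦ (Sr c : ℂ)) x s
  simp only [Kerr.coe_timeTranslate, hairField, hst]
  rw [← mul_assoc]
  congr 1
  rw [phase, phase, ← Complex.exp_add]
  congr 1
  have h0 : (((x : E4) + s • E4.basisVector 0) 0 : ℝ) = (x : E4) 0 + s := by simp [E4.basisVector]
  rw [h0]
  push_cast
  ring

include hF hFode hS hSode hμ in
/-- **The witness solves the Klein–Gordon equation** `□_g Re Ψ = μ² Re Ψ`, `□_g Im Ψ = μ² Im Ψ` for
the prelude's wave operator of `Kerr.smoothMetric M a r₊` (`dalembertian_re_eq`/`_im_eq` +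
`ksBoxC_hairField`). [cite: ShlapentokhRothman2014KleinGordon, §2] -/
theorem dalembertian_hairField (x : exterior M a) :
    (smoothMetric M a (rPlus M a)).toPseudoRiemannianMetric.dalembertian
        (fun y : exterior M a ↦ (hairField a ϖ F Sr y).re) x = μ ^ 2 * (hairField a ϖ F Sr x).re ∧
    (smoothMetric M a (rPlus M a)).toPseudoRiemannianMetric.dalembertian
        (fun y : exterior M a ↦ (hairField a ϖ F Sr y).im) x = μ ^ 2 * (hairField a ϖ F Sr x).im := by
  have h2 : ContDiffAt ℝ 2 (hairField a ϖ F Sr) x := contDiffAt_hairField hF hS x.2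
  have hk := ksBoxC_hairField hF hFode hS hSode hμ x.2
  have hk' : ksBoxC M a (hairField a ϖ F Sr) x = ((μ ^ 2 : ℝ) : ℂ) * hairField a ϖ F Sr x := by
    rw [hk]; push_cast; rfl
  constructor
  · exact (dalembertian_re_eq M a (rPlus M a) x h2).trans (by rw [hk', Complex.re_ofReal_mul])
  · exact (dalembertian_im_eq M a (rPlus M a) x h2).trans (by rw [hk', Complex.im_ofReal_mul])

include hMa hF hF1 hFode hS hS1 hSode hμ in
/-- **The witness is a linear hair** in the sense of `IsLinearHair`. [cite: ChodoshShlapentokhrothman2017, Thm. 1.1 (4) and Rmk. 1.2] -/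
theorem isLinearHair_hairField : IsLinearHair M a μ ϖ fun y : exterior M a ↦ hairField a ϖ F Sr y where
  nonzero := hairField_axisPoint_ne_zero hMa hF1 hS1
  smooth := contMDiff_hairField hF hS
  kleinGordon_re x := (dalembertian_hairField hF hFode hS hSode hμ x).1
  kleinGordon_im x := (dalembertian_hairField hF hFode hS hSode hμ x).2
  periodic := isTimePeriodicField_hairField

end Assembly

/-! ### The discharge -/

/-- **Discharge of the named fact `KerrLinearHair` (existence form).** On every sub-extremal
rotating Kerr exterior and for every `m ≠ 0`: with `ϖ = |am|/(2Mr₊)` and `μ = √(ϖ² + 1/(100a²)) > ϖ`,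
the separated time-harmonic field `e^{−iϖt_KS} F(r) S(cos θ)` — `S` the smooth even spheroidal
eigenfunction of `exists_spheroidalEigenfunction` (`a²(μ² − ϖ²) = 1/100`), `F` a smooth solution of
the separated radial equation on `(r₊, ∞)` with `F(r₊+1) = 1` — is a smooth non-zero solution of
`(□_g − μ²)Ψ = 0` on the open exterior chart, time-periodic with frequency `ϖ`
(`isLinearHair_hairField`). CAVEAT (module docstring): this certifies the VENDORED existence form
only; the witness is axisymmetric and carries no finite-energy or horizon-regularity property, so it
is not one of Shlapentokh-Rothman's bound states (CMP 329 (2014), Thms. 1.2–1.3, which moreover have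
`am ≠ 0`). [cite: ShlapentokhRothman2014KleinGordon, Thms. 1.2–1.3 and §2] -/
theorem KerrLinearHair_holds : KerrLinearHair := by
  intro _ _ M a hMa ha m hm
  obtain ⟨lam, -, Sr, hS, hS1, -, hSode⟩ := exists_spheroidalEigenfunction
  obtain ⟨F, hF, hF1, hFode⟩ := exists_radialFactor (show |a| < M from hMa).le (thresholdFreq M a m) lam (hairMass M a m)
  refine ⟨hairMass M a m, thresholdFreq_lt_hairMass hMa ha m, thresholdFreq M a m,
    fun y ↦ hairField a (thresholdFreq M a m) F Sr y, abs_of_nonneg (thresholdFreq_nonneg hMa m), ?_⟩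
  exact isLinearHair_hairField hMa hF hF1 hFode hS hS1 hSode (sq_mul_hairMass_sq_sub ha m)

end Literature.Barriers.FinalStateConjecture
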